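import Summits.QuantumFields.YangMills.Theorems.UnitScaleTiltFluctuationComparisonRegPrPrintChiTransfer
import Literature.MathematicalPhysics.QuantumFieldTheory.Balaban1983to89.T3AvgDivergenceSplit
import HarnessLib

/-!
# `UnitScaleTiltFluctuationComparisonRegPrPrintChiWindow` — STUB 4′ of crux `FluctuationComparisonRegPrL` (stmt-QuantumFields-19935), (R1) «print's χ back», part 9:
# WHICH WINDOW DATA ARE χ-GOOD — the shrunken window `PlaqSmall (θBal(n)/C′)` with PRINT'S CONSTANT `C′ = max 1 (2B₃/((1−μ)·L√L))` lies inside `ChiGood_μ`, GIVEN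
# [Balaban1985Variational] Thm 1 in the global reading (`Thm1GlobalMinAt`, the schema crux `MinimiserStabilityRegPr`'s line produces); hence the (R1) edge set is
# inside lane A's (R2′) band with an explicit print constant, the doubly-χ-good part of the window has NON-EMPTY INTERIOR (non-vacuity of (ii)*'s frequently-clause),
# and the whole window is χ-good as soon as `2B₃ ≤ (1−μ)·L√L` — the STRUCTURAL form of the block-size floor (`B₃ = 4`: `L√L ≥ 8/(1−μ)`, i.e. `L ≥ 5`)

Cell `ym3-torus`, width-lever lane `ym-ust-19935-r1`; parts 1–8 landed/pending.  Count-neutral helper (`--supports stmt-QuantumFields-19935`).  Pure bookkeeping over tree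
theorems ([Balaban1985Averaging] Prop. 2 = `plaqSmall_iter_blockAvg_eml_level`; [7] Thm 1 as the schema `T3PrintedMinimiserExistence.Thm1GlobalMinAt`); NO numerics, no estimate asserted.

* §1 `chiGood_of_printChi_scaled` — the transfer with a SCALED finest bound: minimiser plaquettes `< s·θBal(n)·L^{−2(K−n)}` and `2s ≤ (1−μ)·L√L` ⇒ `ChiGood_μ` (s = 1: part 5).
* §2 `chiGood_top` — at the top height `n = K` every `δ`-small datum with `δ ≤ ε₀`, `4δ < ε₀` is χ-good (no level below; print-regularity of the datum itself from
  `T3AvgDivergenceSplit.regPr_of_plaqSmall`).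
* §3 `chiGood_of_plaqSmall_shrunk_of_thm1GlobalMinAt` — for `n < K`: [7] Thm 1 puts the minimiser of a `θ(n)/C′`-small datum in (8)(`B₃θ(n)/C′`), i.e. finest plaquettes
  `< (B₃/C′)·θ(n)·η²`, and §1 with `s = B₃/C′` gives `ChiGood_μ` once `C′ ≥ 2B₃/((1−μ)L√L)`; `chiGood_of_window_of_thm1GlobalMinAt` — the whole sharp window when `2B₃ ≤ (1−μ)·L√L`;
  `not_plaqSmall_shrunk_of_not_chiGood` — the (R1) edge set `Win ∖ χ` lies in the band `{¬PlaqSmall (θ/C′)}` (lane A's (R2′) edge region at `C_L := C′`).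

LOCATED CONSEQUENCE (letters, not numbers): with the minimiser gain `B₃` of [7] (the lane's `AlphaConsts.B₃`; FINDING #44's κ_min(3) = 0.96 one level down forces
`2B₃/9 ≥ 0.96`, i.e. `B₃ ≳ 4.3`, at L = 3) the whole window is χ-good iff `L√L ≥ 2B₃/(1−μ)`: false at L = 3 (5.2), true at L = 5 (11.2) for `μ < 1 − 2B₃/11.18` and at every
L ≥ 7 — the registered `7 ≤ L` floor of 3⁗ and lane A's «L = 5 edge band is K = 1-only» in print's constants.  Nothing registered changes; (ii)* at L = 5 becomes the K-small
clauses only, GIVEN `Thm1GlobalMinAt` (19200's currency).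

References: T. Bałaban, CMP 102 (1985) 277–309 [Balaban1985Variational] (Thm 1 (8) p.279); CMP 98 (1985) 17–51 [Balaban1985Averaging] (Prop. 2 (52)–(54) p.26);
CMP 102 (1985) 255–275 [Balaban1985UV3] ((47) p.267).
-/

noncomputable section

namespace Summit.QuantumFields.YangMills.Theorems.PrintChi

open MeasureTheory Filter
open Literature.MathematicalPhysics.QuantumFieldTheory.Balaban1983to89
open Literature.MathematicalPhysics.QuantumFieldTheory.Balaban1983to89.T3ContinuumYM3Torus
open Literature.MathematicalPhysics.QuantumFieldTheory.Balaban1983to89.T3UnitLawDensityEML (ℰp measurableE_ℰp)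
open Literature.MathematicalPhysics.QuantumFieldTheory.Balaban1983to89.T3UnitScaleTilt
open Literature.MathematicalPhysics.QuantumFieldTheory.Balaban1983to89.T3TiltDescent
open Literature.MathematicalPhysics.QuantumFieldTheory.Balaban1983to89.T3ConstrainedMinimiser
open Literature.MathematicalPhysics.QuantumFieldTheory.Balaban1983to89.T3DescentFibreTower
open Literature.MathematicalPhysics.QuantumFieldTheory.Balaban1983to89.T3RegularMinimiser
open Literature.MathematicalPhysics.QuantumFieldTheory.Balaban1983to89.T3PrintedRegularMinimiser
open Literature.MathematicalPhysics.QuantumFieldTheory.Balaban1983to89.T3PrintedMinimiserExistence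
open Literature.MathematicalPhysics.QuantumFieldTheory.Balaban1983to89.T3AvgDivergenceSplit (regPr_of_plaqSmall)
open Literature.MathematicalPhysics.QuantumFieldTheory.Balaban1983to89.ExpMeanLog (deltaSU deltaSU_pos)
open Literature.MathematicalPhysics.QuantumFieldTheory.Balaban1983to89.BlockAveragingEMLProp2 (plaqSmall_iter_blockAvg_eml_level)
open Literature.MathematicalPhysics.QuantumFieldTheory.Balaban1983to89.Missing

variable {F : T3Family} {γ b₀ p₀ ε₀ μ : ℝ}

/-- Weakening a plaquette bound (local helper). [folklore] -/
private theorem plaqSmall_le {P : Params} {j : ℕ} {G : Type*} [GaugeGroup G] {δ δ' : ℝ} (hδ : δ ≤ δ')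
    {U : GaugeField P j G} (hU : PlaqSmall δ U) : PlaqSmall δ' U :=
  fun p => (hU p).trans_le hδ

/-! ## §1 The transfer with a scaled finest bound -/

/-- **THE TRANSFER, SCALED**: a regular minimiser `U` of `V` with finest plaquettes `< s·θBal(n)·L^{−2(K−n)}` (`s > 0`; print's χ_k is `s = 1`, [7] Thm 1 gives `s = B₃`
for window data) is a χ-witness with margin `μ` whenever `2s ≤ (1−μ)·L√L` and `sθBal(n)` is below print's averaging constants ([Balaban1985Averaging] Prop. 2 via
`plaqSmall_iter_blockAvg_eml_level`, then part 1's `chiGood_of_printChi` with `a = 2s`). [cite: Balaban1985Averaging, Prop. 2 (52)–(54) p.26] -/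
theorem chiGood_of_printChi_scaled (hγ : 0 < γ) (hγ1 : γ ≤ 1) (hb : 0 < b₀) (hp : 0 ≤ p₀) {n K : ℕ} (h : n ≤ K)
    {V : GaugeField (F.P n) 0 (Matrix.specialUnitaryGroup (Fin 2) ℂ)} {U : GaugeField (F.P K) 0 (Matrix.specialUnitaryGroup (Fin 2) ℂ)}
    (hU : U ∈ regFibrePr F n K h ε₀ V) (hmin : wilsonAction4 U = minActionRegPr F n K h ε₀ V) {s : ℝ} (hs : 0 < s)
    (hχ : PlaqSmall (s * θBal F.L γ b₀ p₀ n * ((F.L : ℝ)⁻¹) ^ (2 * (K - n))) U)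
    (hθ3 : (143 * ((((3 + 4 : ℕ) : ℝ)) ^ 2 / 4) ^ 2) * (s * θBal F.L γ b₀ p₀ n) ≤ 1 / 3)
    (hθ2 : 2 * (s * θBal F.L γ b₀ p₀ n) ≤ 2 * deltaSU (Fin 2) / (((3 + 4) * F.L : ℕ) : ℝ) ^ 2)
    (hμ : 2 * s ≤ (1 - μ) * ((F.L : ℝ) * Real.sqrt F.L)) :
    ChiGood F γ b₀ p₀ ε₀ μ h V := by
  have hL : 1 ≤ F.L := F.hL.2.le
  have hθ : 0 < θBal F.L γ b₀ p₀ n := T3MinimiserStabilityReduction.θBal_pos hL hγ hγ1 hb p₀ n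
  have hsθ : 0 < s * θBal F.L γ b₀ p₀ n := mul_pos hs hθ
  refine chiGood_of_printChi hγ hγ1 hb hp h hU hmin (a := 2 * s) (by linarith) hμ fun j hj => ?_
  have h52 : PlaqSmall (s * θBal F.L γ b₀ p₀ n * ((((F.P K).L : ℝ) ^ (K - n))⁻¹) ^ 2) U := by
    refine plaqSmall_le (le_of_eq ?_) hχ
    show s * θBal F.L γ b₀ p₀ n * ((F.L : ℝ)⁻¹) ^ (2 * (K - n)) = s * θBal F.L γ b₀ p₀ n * ((((F.L : ℝ)) ^ (K - n))⁻¹) ^ 2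
    rw [← inv_pow, ← pow_mul, mul_comm (K - n) 2]
  have hlev := plaqSmall_iter_blockAvg_eml_level (P := F.P K) (n := Fin 2) (K - n) hsθ hθ3 hθ2 h52 (j := j) (by omega)
  refine plaqSmall_le (le_of_eq ?_) hlev
  show 2 * (s * θBal F.L γ b₀ p₀ n) * ((F.L : ℝ) ^ j * ((F.L : ℝ) ^ (K - n))⁻¹) ^ 2 =
    2 * s * (F.L : ℝ) ^ (2 * j) * (θBal F.L γ b₀ p₀ n * ((F.L : ℝ)⁻¹) ^ (2 * (K - n)))
  rw [← inv_pow, mul_pow, ← pow_mul, ← pow_mul, mul_comm j 2, mul_comm (K - n) 2]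
  ring

/-! ## §2 The top height: every small datum is χ-good -/

/-- **AT THE TOP HEIGHT `n = K` EVERY SMALL DATUM IS χ-GOOD** (any margin `μ`): the fibre of `V` over itself is `{V}` (`descendTo_self`), `V` is print-regular for the
height-`K` problem once `PlaqSmall δ V` with `δ ≤ ε₀`, `4δ < ε₀` (`regPr_of_plaqSmall`: the divergence clause follows from plaquette smallness), it attains its own regular
minimum, and there is no level below to constrain. [cite: Balaban1985Variational, (2) (6) p.278] -/
theorem chiGood_top {K : ℕ} {V : GaugeField (F.P K) 0 (Matrix.specialUnitaryGroup (Fin 2) ℂ)} {δ : ℝ} (hV : PlaqSmall δ V) (hδ : δ ≤ ε₀) (h4 : 4 * δ < ε₀) :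
    ChiGood F γ b₀ p₀ ε₀ μ (le_refl K) V := by
  have hreg : RegPr F K K ε₀ V := by
    refine regPr_of_plaqSmall F hV ?_ ?_
    · show δ ≤ ε₀ * ((F.L : ℝ)⁻¹) ^ (2 * (K - K))
      rw [Nat.sub_self, mul_zero, pow_zero, mul_one]; exact hδ
    · rw [Nat.sub_self, mul_zero, pow_zero, mul_one]; exact h4
  have hfib : V ∈ fibre F ℰp K K (le_refl K) V := descendTo_self F ℰp K V
  have hU : V ∈ regFibrePr F K K (le_refl K) ε₀ V := (mem_regFibrePr_iff F).mpr ⟨hfib, hreg⟩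
  refine ⟨V, hU, ?_, fun j hj => by omega⟩
  refine le_antisymm ?_ (minActionRegPr_le F hU)
  refine le_csInf ⟨_, V, hU, rfl⟩ ?_
  rintro _ ⟨W, hW, rfl⟩
  have hWV : W = V := by
    have h1 : W ∈ fibre F ℰp K K (le_refl K) V := ((mem_regFibrePr_iff F).mp hW).1
    rw [mem_fibre_iff, descendTo_self] at h1
    exact h1
  rw [hWV]

/-! ## §3 Which window data are χ-good below the top: the shrunken window with print's constant, given [7] Thm 1 -/

/-- **THE SHRUNKEN WINDOW WITH PRINT'S CONSTANT LIES INSIDE `ChiGood_μ`, GIVEN [7] THM 1** (`n < K`, `μ < 1`, `B₃ > 0`, `C′ := max 1 (2B₃/((1−μ)·L√L))`): if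
`Thm1GlobalMinAt L a₀ a₁ B₃` holds (the global reading of [Balaban1985Variational] Thm 1 for the family's fibres — the schema crux `MinimiserStabilityRegPr`'s line supplies),
`θBal(n) ≤ a₁`, `B₃θBal(n) ≤ ε₀ ≤ a₀` (the route's standing thresholds) and `B₃θBal(n)` is below print's averaging constants, then every datum with `PlaqSmall (θBal(n)/C′) V` is
χ-good with margin `μ`: Thm 1 puts a minimiser over (6)(ε₀) into (8)(B₃θ/C′) — finest plaquettes `< (B₃/C′)·θ(n)·η²` — and §1 applies with `s = B₃/C′`, `2s ≤ (1−μ)L√L` by the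
choice of `C′`. [cite: Balaban1985Variational, Thm 1 (8) p.279] -/
theorem chiGood_of_plaqSmall_shrunk_of_thm1GlobalMinAt (hγ : 0 < γ) (hγ1 : γ ≤ 1) (hb : 0 < b₀) (hp : 0 ≤ p₀) (hμ : μ < 1)
    {a₀ a₁ B₃ : ℝ} (hB₃ : 0 < B₃) (hT : Thm1GlobalMinAt F.L a₀ a₁ B₃) {n K : ℕ} (h : n < K)
    (ha₁ : θBal F.L γ b₀ p₀ n ≤ a₁) (hlo : B₃ * θBal F.L γ b₀ p₀ n ≤ ε₀) (hhi : ε₀ ≤ a₀)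
    (hθ3 : (143 * ((((3 + 4 : ℕ) : ℝ)) ^ 2 / 4) ^ 2) * (B₃ * θBal F.L γ b₀ p₀ n) ≤ 1 / 3)
    (hθ2 : 2 * (B₃ * θBal F.L γ b₀ p₀ n) ≤ 2 * deltaSU (Fin 2) / (((3 + 4) * F.L : ℕ) : ℝ) ^ 2)
    {V : GaugeField (F.P n) 0 (Matrix.specialUnitaryGroup (Fin 2) ℂ)}
    (hV : PlaqSmall (θBal F.L γ b₀ p₀ n / max 1 (2 * B₃ / ((1 - μ) * ((F.L : ℝ) * Real.sqrt F.L)))) V) :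
    ChiGood F γ b₀ p₀ ε₀ μ h.le V := by
  have hL : 1 ≤ F.L := F.hL.2.le
  have hL0 : (0 : ℝ) < F.L := by exact_mod_cast (show 0 < F.L by omega)
  have hLs : 0 < (F.L : ℝ) * Real.sqrt F.L := by positivity
  have hθ : 0 < θBal F.L γ b₀ p₀ n := T3MinimiserStabilityReduction.θBal_pos hL hγ hγ1 hb p₀ n
  set C' : ℝ := max 1 (2 * B₃ / ((1 - μ) * ((F.L : ℝ) * Real.sqrt F.L))) with hC'
  have hC'1 : 1 ≤ C' := le_max_left _ _
  have hC'0 : 0 < C' := lt_of_lt_of_le one_pos hC'1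
  -- the datum radius `ε₁ = θ(n)/C′`
  have hε₁ : 0 < θBal F.L γ b₀ p₀ n / C' := div_pos hθ hC'0
  have hε₁θ : θBal F.L γ b₀ p₀ n / C' ≤ θBal F.L γ b₀ p₀ n := div_le_self hθ.le hC'1
  have hε₁a : θBal F.L γ b₀ p₀ n / C' ≤ a₁ := hε₁θ.trans ha₁
  have hlo' : B₃ * (θBal F.L γ b₀ p₀ n / C') ≤ ε₀ := (mul_le_mul_of_nonneg_left hε₁θ hB₃.le).trans hlo
  obtain ⟨U, hU8, hmin8⟩ := hT F rfl n K h _ ε₀ hε₁ hε₁a hlo' hhi V hV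
  have hU6 : U ∈ regFibrePr F n K h.le ε₀ V := regFibrePr_mono F hlo' V hU8
  have hmin : wilsonAction4 U = minActionRegPr F n K h.le ε₀ V := minActionRegPr_eq_of_isMinOn F hU6 hmin8
  -- finest plaquettes of the minimiser: `(B₃/C′)·θ(n)·η²`
  have hfin : PlaqSmall (B₃ / C' * θBal F.L γ b₀ p₀ n * ((F.L : ℝ)⁻¹) ^ (2 * (K - n))) U := by
    refine plaqSmall_le (le_of_eq ?_) ((mem_regFibrePr_iff F).mp hU8).2.1
    show regThreshold F n K (B₃ * (θBal F.L γ b₀ p₀ n / C')) = _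
    unfold regThreshold
    field_simp
  have hs : 0 < B₃ / C' := div_pos hB₃ hC'0
  have hsB : B₃ / C' * θBal F.L γ b₀ p₀ n ≤ B₃ * θBal F.L γ b₀ p₀ n :=
    mul_le_mul_of_nonneg_right (div_le_self hB₃.le hC'1) hθ.le
  refine chiGood_of_printChi_scaled hγ hγ1 hb hp h.le hU6 hmin hs hfin ?_ ?_ ?_
  · exact (mul_le_mul_of_nonneg_left hsB (by positivity)).trans hθ3
  · linarith
  · -- `2B₃/C′ ≤ (1−μ)·L√L` by the choice of `C′`
    have hμ0 : 0 < 1 - μ := by linarith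
    have hC'2 : 2 * B₃ / ((1 - μ) * ((F.L : ℝ) * Real.sqrt F.L)) ≤ C' := le_max_right _ _
    rw [div_le_iff₀ (mul_pos hμ0 hLs)] at hC'2
    rw [show 2 * (B₃ / C') = 2 * B₃ / C' by ring, div_le_iff₀ hC'0]
    linarith [mul_comm C' ((1 - μ) * ((F.L : ℝ) * Real.sqrt F.L))]

/-- **THE WHOLE SHARP WINDOW IS χ-GOOD WHEN `2B₃ ≤ (1−μ)·L√L`** (then `C′ = 1`), given [7] Thm 1 and the standing thresholds: the STRUCTURAL form of the block-size
floor — with [7]'s minimiser gain `B₃` the (R1) edge set `Win ∖ χ_μ` is EMPTY at every `L` with `L√L ≥ 2B₃/(1−μ)`. [cite: Balaban1985Variational, Thm 1 (8) p.279] -/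
theorem chiGood_of_window_of_thm1GlobalMinAt (hγ : 0 < γ) (hγ1 : γ ≤ 1) (hb : 0 < b₀) (hp : 0 ≤ p₀) (hμ : μ < 1)
    {a₀ a₁ B₃ : ℝ} (hB₃ : 0 < B₃) (hT : Thm1GlobalMinAt F.L a₀ a₁ B₃) {n K : ℕ} (h : n < K)
    (ha₁ : θBal F.L γ b₀ p₀ n ≤ a₁) (hlo : B₃ * θBal F.L γ b₀ p₀ n ≤ ε₀) (hhi : ε₀ ≤ a₀)
    (hθ3 : (143 * ((((3 + 4 : ℕ) : ℝ)) ^ 2 / 4) ^ 2) * (B₃ * θBal F.L γ b₀ p₀ n) ≤ 1 / 3)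
    (hθ2 : 2 * (B₃ * θBal F.L γ b₀ p₀ n) ≤ 2 * deltaSU (Fin 2) / (((3 + 4) * F.L : ℕ) : ℝ) ^ 2)
    (hfloor : 2 * B₃ ≤ (1 - μ) * ((F.L : ℝ) * Real.sqrt F.L))
    {V : GaugeField (F.P n) 0 (Matrix.specialUnitaryGroup (Fin 2) ℂ)} (hV : PlaqSmall (θBal F.L γ b₀ p₀ n) V) :
    ChiGood F γ b₀ p₀ ε₀ μ h.le V := by
  have hL : 1 ≤ F.L := F.hL.2.le
  have hL0 : (0 : ℝ) < F.L := by exact_mod_cast (show 0 < F.L by omega)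
  have hLs : 0 < (F.L : ℝ) * Real.sqrt F.L := by positivity
  have hμ0 : 0 < 1 - μ := by linarith
  have hC' : max 1 (2 * B₃ / ((1 - μ) * ((F.L : ℝ) * Real.sqrt F.L))) = 1 := by
    refine max_eq_left ?_
    rw [div_le_iff₀ (mul_pos hμ0 hLs)]
    linarith
  refine chiGood_of_plaqSmall_shrunk_of_thm1GlobalMinAt hγ hγ1 hb hp hμ hB₃ hT h ha₁ hlo hhi hθ3 hθ2 ?_
  rw [hC', div_one]
  exact hV

/-- **THE (R1) EDGE SET LIES IN THE (R2′) BAND WITH PRINT'S CONSTANT**: under the hypotheses of `chiGood_of_plaqSmall_shrunk_of_thm1GlobalMinAt`, a window datum that is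
NOT χ-good with margin `μ` has its largest plaquette variable `≥ θBal(n)/C′`, `C′ = max 1 (2B₃/((1−μ)L√L))` — lane A's edge band `{¬PlaqSmall (θBal/C_L)}` at `C_L := C′`.
[cite: Balaban1985Variational, Thm 1 (8) p.279] -/
theorem not_plaqSmall_shrunk_of_not_chiGood (hγ : 0 < γ) (hγ1 : γ ≤ 1) (hb : 0 < b₀) (hp : 0 ≤ p₀) (hμ : μ < 1)
    {a₀ a₁ B₃ : ℝ} (hB₃ : 0 < B₃) (hT : Thm1GlobalMinAt F.L a₀ a₁ B₃) {n K : ℕ} (h : n < K)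
    (ha₁ : θBal F.L γ b₀ p₀ n ≤ a₁) (hlo : B₃ * θBal F.L γ b₀ p₀ n ≤ ε₀) (hhi : ε₀ ≤ a₀)
    (hθ3 : (143 * ((((3 + 4 : ℕ) : ℝ)) ^ 2 / 4) ^ 2) * (B₃ * θBal F.L γ b₀ p₀ n) ≤ 1 / 3)
    (hθ2 : 2 * (B₃ * θBal F.L γ b₀ p₀ n) ≤ 2 * deltaSU (Fin 2) / (((3 + 4) * F.L : ℕ) : ℝ) ^ 2)
    {V : GaugeField (F.P n) 0 (Matrix.specialUnitaryGroup (Fin 2) ℂ)} (hV : ¬ ChiGood F γ b₀ p₀ ε₀ μ h.le V) :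
    ¬ PlaqSmall (θBal F.L γ b₀ p₀ n / max 1 (2 * B₃ / ((1 - μ) * ((F.L : ℝ) * Real.sqrt F.L)))) V :=
  fun hs => hV (chiGood_of_plaqSmall_shrunk_of_thm1GlobalMinAt hγ hγ1 hb hp hμ hB₃ hT h ha₁ hlo hhi hθ3 hθ2 hs)

end Summit.QuantumFields.YangMills.Theorems.PrintChi

end
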